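import Summits.CriticalPhenomena.PercolationContinuityZ3.Theorems.Transplant.SkelPhiConcFaceObl
import Summits.CriticalPhenomena.PercolationContinuityZ3.Theorems.Transplant.SkelPhiConcRealised
import HarnessLib

/-!
# D″ node, (F) part 4b at φ-level (DPRIME-SCOPE §2 L6′, hp-8 column): the RUN form of the face obligation at the two-unit schedule of record
# `Skelφ.concRadii2S P gap gap' E₀ L'` (p2-g7) with the radii REALISED along runs (p5-g6's `Skelφ.realised_of_choice_SG`), modulo the kit
# clauses along runs — φ-level re-cut of `SkelConcFaceObl` §2 `Skel.faceOblR_concS` (hp-8 g24, p235972)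

builds on p205010 (kernel theorem, internal audit signed; external expert review pending) — nothing in this file uses p205010.
Lane `prim-bschramm`, seat `prim-hp-8` (gen 30; L6′ (F) owner); helper file (`--supports stmt-CriticalPhenomena-4575`).  Hypotheses through
p3-g7's dictionary: `hlip : Skelφ.Lip G φ`, `hstep : Skelφ.Steps G φ`; data `P : PCells2`, the root `w₀` in base position (`φ w₀ = 0`), the gap
functions and `E₀, L'` of the schedule, the running parameter `q`, `δc`.  Two units enter only through `20 rmax` (offset / gap floor) and `50 rmax`
(planar diameter of the excess radius) and the transverse room `Rlev + 3 ≤ 3 r⊥` of the face-step levels (required for BOTH axes: `3 r₀`, `3 r₁`).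
* **`faceOblR_concS (hlip) (hstep)`** — at `Λ := Skelφ.concRadii2S P gap gap' E₀ L'` (`gap ≥ 1`, `gap ≥ 20 rmax + 2 L' + R₁ ·`, `E₀ ≥ 2`, `L' ≥ 1`):
  along RUN histories the anchors of the chosen edge are realised, so with `g := nQ (aOf₁) x`: `rM_{a'}(x+du) = E g + gap (E g) − L'`,
  `ρ ≤ E g − 2`, `rQ_{aOf₁}(x) = E g`; entrance depth `E g + 1`, excess radius `R₁ (E g)` ⟹ `Skelφ.FaceOblR G φ S (faceDataSG …) Δ' δ₂` MODULO
  the kit clauses along runs (hypothesis `hkits`, verbatim shape of part 4).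
[cite: KozmaNitzan2024, §4 p. 27 ((30)), p. 30 (Step III), Lemma 10 (p. 17), Lemma 12 (p. 24)] [cite: MartineauSevero2019, Cor. 2.2]
-/

noncomputable section

open MeasureTheory
open scoped Classical

namespace Summit.CriticalPhenomena.PercolationContinuityZ3.Theorems.Transplant

namespace Skelφ

open Literature.Probability.Percolation Literature.Probability.LatticeModels SimpleGraph KNCells KNLevels GadgetSystem Contour
open Literature.Probability.Percolation.KozmaNitzan
open Literature.Probability.Percolation.KozmaNitzan.Cells (oth oth_ne sgOf sgOf_sign stepVec_apply_fst stepVec_apply_oth eq_oth_of_ne oth_oth)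
open Literature.Barriers.CriticalPhenomena (graphBall graphBall_finite mem_graphBall_self graphBall_mono)
open BoxProdZ2 (ConcRadiiG Erad Frad nQ nS Realised Frad_succ Frad_le_Erad)
open Skel (winGraph WinStepData excess)

variable {V : Type} [DecidableEq V] [Countable V] {G : SimpleGraph V} [G.LocallyFinite] {φ : V → Site 2}
variable (P : PCells2) (w₀ : V) (gap gap' : ℕ → ℕ) (E₀ L' : ℕ) (q : unitInterval) (δc : ℝ)

/-- **`FaceOblR` for the scheme of record at the two-unit schedule of record, modulo the kit clauses along runs** (from `Lip`, `Steps`)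
(φ-level form of `Skel.faceOblR_concS`). [cite: KozmaNitzan2024, §4 p. 30 (Step III), Lemma 10 (p. 17), Lemma 12 (p. 24)]
[cite: MartineauSevero2019, Cor. 2.2] -/
theorem faceOblR_concS (hlip : Lip G φ) (hstep : Steps G φ) (hgap : ∀ n, 1 ≤ gap n) (hgap20 : ∀ n, 20 * P.rmax ≤ gap n) (hE₀ : 2 ≤ E₀)
    (hL' : 1 ≤ L') (hφ : φ w₀ = 0) {Δ' Rlev N M : ℕ} {δ₂ : ℝ} (hRlev : Rlev + 4 ≤ 10 * P.s 0 ∧ Rlev + 4 ≤ 10 * P.s 1)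
    (hRlev' : Rlev + 3 ≤ 3 * P.r 0 ∧ Rlev + 3 ≤ 3 * P.r 1)
    (hcount : 1 / (1 - (q : ℝ)) ^ (Δ' * N) ≤ δ₂ * ((Finset.Icc (M + 1) Rlev).card : ℝ))
    {η : ℝ} (hη : η ≤ δc / 2) (R₁ : ℕ → ℕ)
    (hR₁ : ∀ ρ R', R₁ ρ ≤ R' → ∀ (Rw : ℕ) (D' A' : Finset V), (∀ d ∈ D', d ∈ graphBall G w₀ Rw) →
      (∀ d ∈ D', ∀ d' ∈ D', φ d - φ d' ∈ box 2 (50 * P.rmax)) → A' ⊆ D' → (∀ a ∈ A', a ∈ graphBall G w₀ (ρ + 1)) →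
        (bondPercolation G q).real (excess G w₀ R' D' A') ≤ η)
    (hgapR : ∀ ρ, 20 * P.rmax + 2 * L' + R₁ ρ ≤ gap ρ)
    (hkits : ∀ (h : ProbeHistory V) (e : Site 2 × MDir),
      let Λ := concRadii2S P gap gap' E₀ L'
      let S : KSchA V ℕ := ⟨cellGeomSG G φ P w₀ Λ, q, δc⟩
      S.IsRun₂ G h → (S.astOf₂ G h).st.choice = some e → S.Valid₂ G h e →
      ∀ du ∈ S.onward G h (tgt e), ∀ j < P.K, ∀ o : Finset (Sym2 V),
      let a := S.aOf₁ G h e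
      let a' := S.aOf₂ G h e
      let Q := faceStepW G φ P w₀ Λ a' (tgt e) du j Rlev N M L' (S.Sx G h e a a' du)
      ∀ j' ∈ Finset.Icc Q.j₀ Q.j₁, ∃ (σ : KNLevels.SData V) (Sz : Finset V),
        KNLevels.SHyp (winLData G φ Q.root Q.Rπ Q.lo Q.hi Q.root Q.Sfin) j' σ ∧ σ.N ≤ Q.N ∧
        (1 - (S.p : ℝ) ^ σ.sB) ^ σ.k ≤ δ₂ ∧ Sz ⊆ (winLData G φ Q.root Q.Rπ Q.lo Q.hi Q.root Q.Sfin).X j' ∧ Sz ⊆ stepRg G φ Q ∧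
        (∀ x ∈ σ.K, ∀ e' ∈ σ.seed x, e' ∉ wireSet (↑Sz : Set V)) ∧ (∀ x ∈ σ.K, σ.face x ⊆ Sz) ∧
        (∀ x ∈ σ.K, 1 - 3 * δ₂ ≤ (prodBernoulli (S.Wt G h e a a' du j o)).real {ω | ∃ u ∈ σ.face x,
          1 - δ₂ < (prodBernoulli (pinW (S.Wt G h e a a' du j o) (wireSet (↑Sz : Set V)) ω)).real
            (⋃ t ∈ Q.T, openConnIn (↑(stepRg G φ Q) : Set V) u t)})) :
    FaceOblR G φ (⟨cellGeomSG G φ P w₀ (concRadii2S P gap gap' E₀ L'), q, δc⟩ : KSchA V ℕ)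
      (faceDataSG G φ P w₀ (concRadii2S P gap gap' E₀ L')) Δ' δ₂ := by
  intro h e hrun hc hV du hdu j hj o
  set Λ := concRadii2S P gap gap' E₀ L' with hΛdef
  set S : KSchA V ℕ := ⟨cellGeomSG G φ P w₀ Λ, q, δc⟩ with hS
  have hΛ : WFS2 P Λ := concRadii2S_WFS2 P gap gap' E₀ L' hgap hE₀ hL'
  have hr : Realised (S.aOf₁ G h e) (S.aOf₂ G h e) (tgt e) := realised_of_choice_SG h hc
  have hy : tgt e + stepVec du ≠ 0 := tgt_add_stepVec_ne_zero hφ hV hdu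
  have hE₀' : 1 ≤ E₀ := by omega
  have hxn : (tgt e 0).natAbs + (tgt e 1).natAbs ≤ nQ (S.aOf₁ G h e) (tgt e) :=
    Skel.l1_tgt_le_nQ (cellGeomSG_anchor G φ P w₀ Λ q δc) (cellGeomSG_a₀ G φ P w₀ Λ q δc) h hc
  set g := nQ (S.aOf₁ G h e) (tgt e) with hg
  obtain ⟨h1, h2, h3⟩ := hr.sched_hyps hy
  -- the realised radii
  have hrM : Λ.rM (S.aOf₂ G h e) (tgt e + stepVec du) = Erad gap gap' E₀ g + gap (Erad gap gap' E₀ g) - L' := by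
    change Frad gap gap' E₀ (nQ (S.aOf₂ G h e) (tgt e + stepVec du)) - L' = _
    rw [hr.nQ_add_stepVec hy, Frad_succ]
  have hρ : ∀ ℓ, Λ.ρ (S.aOf₂ G h e) (tgt e) du ℓ ≤ Erad gap gap' E₀ g := fun ℓ =>
    (concRadii2S_ρ_le P gap gap' E₀ L' _ _ _ ℓ).trans (by rw [hr.nS_eq]; exact Nat.sub_le _ _)
  have hQ : Λ.rQ (S.aOf₁ G h e) (tgt e) ≤ Erad gap gap' E₀ g := (concRadii2S_rQ_eq_of_norm_le P gap gap' E₀ L' hgap20 hE₀' hxn).le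
  have hgapg := hgapR (Erad gap gap' E₀ g)
  have hRlev₁ : Rlev + 4 ≤ 10 * P.s du.1 := by
    rcases du with ⟨i, b⟩; fin_cases i; exacts [hRlev.1, hRlev.2]
  have hRlev₂ : Rlev + 3 ≤ 3 * P.r (oth du.1) := by
    rcases du with ⟨i, b⟩; fin_cases i; exacts [hRlev'.2, hRlev'.1]
  refine faceOblAt_concSG (S := S) rfl hΛ hV hdu hlip hstep (show j + 1 ≤ P.K from hj) hRlev₁ hRlev₂ hcount
    (M_succ_nonempty_real P w₀ gap gap' E₀ L' hstep hgap20 hE₀' hφ hr hy hxn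
      (show 20 * P.rmax + L' ≤ gap (Erad gap gap' E₀ g) by omega)) (hkits h e hrun hc hV du hdu j hj o) hQ hρ hη
    (hR₁ (Erad gap gap' E₀ g)) ?_
  rw [hrM]; omega

end Skelφ

end Summit.CriticalPhenomena.PercolationContinuityZ3.Theorems.Transplant

end
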